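import Mathlib
import Literature.NumberTheory.Kottwitz1992.GroupStructure
import HarnessLib

/-!
# Kottwitz 1992, §8 «Complex points of moduli spaces of PEL type» — statements as printed (carpet, no proofs)

[Kottwitz1992] R. E. Kottwitz, *Points on some Shimura varieties over finite fields*, J. Amer. Math.
Soc. **5** (1992) 373–444, §8, pp. 398–400.  SOURCE READ: held text `paper:doi-10-2307-2152772`
(pdf page `p00NN` = printed page `372 + NN`; §8 = p0026 L26 – p0028 L44).  Squad TK (HCML «GO 500»,
seat TK-t03), target `Literature/NumberTheory/Kottwitz1992/ComplexPoints.lean`; vocabulary of the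
landed §7 carpet `Literature.NumberTheory.Kottwitz1992.GroupStructure` (skew-Hermitian modules,
`similitudes`, Cases A∕C∕D, presentations `IsAlgebraExtension`∕`IsModuleExtension` of extensions of
scalars, `LocallyIsomorphic`, `Isomorphic`, `IsOBLattice`, `IsSelfDual`, `IsPadicDatum`).

§8 has NO numbered statement.  It proves, for a complex point `(A, λ, i, η̄)` of `S_{K^p}` («`A` is now
an abelian variety over `ℂ` up to prime-to-`p` isogeny», p. 398) with `H := H₁(A, ℚ)` («a skew-Hermitian
`B`-module, the `B`-action coming from `i` and the alternating form coming from `λ`; … the form is only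
well determined up to scalars», p0026 L31–L35):

(8.1) «We claim that for every place `v` of `ℚ` the skew-Hermitian `B_{ℚ_v}`-modules `H_{ℚ_v}` and
  `V_{ℚ_v}` are isomorphic.» (p0026 L36–L37) — finite `v ≠ p`: «an immediate consequence of the
  existence of `η̄`»; `v = ∞`: the determinant condition and Lemma 4.2 (p0026 L39 – p0027 L7); `v = p`:
  Lemma 7.2 applied to the self-dual `𝒪_B`-lattice `Λ' := H₁(A, ℤ_p)` (p0027 L8–L30, with the Case-D
  check via Shapiro's lemma and weak approximation);
(8.2) «Isomorphism classes of skew-Hermitian `B`-modules of the same dimension as `V` are classified by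
  `H¹(ℚ, G)`, and therefore by [BS] there are finitely many isomorphism classes of skew-Hermitian
  `B`-modules `(V', (·,·)')` such that `V'_{ℚ_v}` and `V_{ℚ_v}` are isomorphic for all places `v` of `ℚ`»
  (p0027 L31–L35) ([BS] = Borel–Serre, finiteness of `ker¹`);
(8.3) the bijection `S_{K^p}(ℂ)^{(i)} → G^{(i)}(ℚ) \ ((G(𝔸_f)/K) × X_∞)`, `K = K_p·K^p`, `K_p` the
  stabilizer of a self-dual `𝒪_B`-lattice `Λ₀ ⊂ V_{ℚ_p}` (p0027 L46 – p0028 L15: «The theory of abelian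
  varieties over `ℂ` shows that this construction yields a bijection»);
(8.4) «In Case C and in Case A with `n` even, the situation is simple: `G` is connected and satisfies the
  Hasse principle.» (p0028 L19–L20); Case A, `n` odd: «`H¹(ℚ, Z) = F₀^×/ℚ^× N_{F/F₀}(F^×)`», the
  automorphism «`(A, λ, i, η̄) ↦ (A, λ∘i(a), i, βη̄)`» of `S_{K^p}` attached to a totally positive
  `a ∈ F₀^×` representing `z ∈ ker¹(ℚ, Z)` (p0028 L21–L37), and «Therefore our moduli space over `E` is
  just a disjoint union of `|ker¹(ℚ, G)|` copies of the canonical model `S_K^{(1)}` for `(G, h⁻¹, K^p)`.»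
  (p0028 L38–L44).

TYPED here, on the linear-algebra SHADOW `(H, ψ)` of a complex point (a nondegenerate skew-Hermitian
`B`-module over `ℚ`, `B`-isomorphic to `V` — p0026 L39–L40 «the `B`-modules `H` and `V` are isomorphic») and
in the READING R-H1 of the §7 carpet (`H¹(ℚ_v, G)`-classes ⟷ local isomorphism classes of forms): (8.1) as
`Kottwitz1992_8_localIso_real` (real-place data `HasCompatibleComplexStructures`),
`Kottwitz1992_8_localIso_padic` (`p`-adic data `HasSelfDualLatticeAt`) and the headline
`Kottwitz1992_8_localIso_everywhere`; (8.2) as `Kottwitz1992_8_finitely_many_classes`; of (8.4) the twist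
`(H, ψ) ↦ (H, ψ_a)` with its target class, `Kottwitz1992_8_twist_class` (the group-theoretic input
`ker¹(ℚ, Z) ≅ ker¹(ℚ, G)` is the §7 carpet's `Kottwitz1992_7_kerOne_center_bijective`, the Hasse principle
its `Kottwitz1992_7_hassePrinciple`; neither is restated).

NOT TYPED (no faithful Lean target in this file; said plainly): the bijection (8.3) itself and the
`E`-structure ∕ canonical-model sentences of (8.4) — they need complex abelian varieties up to prime-to-`p`
isogeny ⟷ polarizable Hodge structures (Riemann's theorem), the adelic group `G(𝔸_f)` and Deligne's
canonical models, none of which this statements-only file may posit as data without proof obligations.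
The real-place input «Lemma 4.2» is t02's landed `Literature.NumberTheory.Kottwitz1992.
HermitianSymmetricSpaces.Kottwitz1992_4_2_iso` (cited, not restated; its `SkewHermitianForm ρ`∕`HodgeMap`
presentation is equivalent to the `(ι_ℝ, φ_ℝ, J)` presentation used below, `J = h(i)`).
Dedup: `rg 'Kottwitz1992, §8'` — 4 tree files cite §8 words inside AbelianSchemes∕ShimuraVarieties prover
files (Siegel∕unitary comparison maps); none states (8.1)–(8.4).  Nothing is proved; every `def … : Prop`
is a predicate on the data it binds; `∀ data, P data` is NOT claimed.
-/

open Module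

namespace Literature.NumberTheory.Kottwitz1992.ComplexPoints

open Literature.NumberTheory.Kottwitz1992.GroupStructure

/-! ## The real place: complex structures `J = h(i)` and Lemma 4.2 applied (p. 398–399) -/

section Real

variable {Bℝ : Type} [Ring Bℝ] [Algebra ℝ Bℝ] (ιℝ : Bℝ →ₗ[ℝ] Bℝ)
variable {W : Type} [AddCommGroup W] [Module ℝ W] [Module Bℝ W] [IsScalarTower ℝ Bℝ W]
  (χ : LinearMap.BilinForm ℝ W)

/-- A **polarizing complex structure** on the real skew-Hermitian `B_ℝ`-module `(W, χ)`: a `B_ℝ`-linear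
`J` with `J² = -1`, `χ(Jv, Jw) = χ(v, w)` and `χ(v, Jv) > 0` for `v ≠ 0` — i.e. `J = h(i)` for the
`*`-homomorphism «`h : ℂ → C_ℝ` … such that the symmetric real-valued bilinear form `(v, h(i)w)` on `V_ℝ`
is positive definite» (§5 p. 389, p0017 L29–L31); for a complex point, «the natural complex structure on
`H_ℝ = Lie(A)`» (p. 398, p0026 L42–L43), polarizing because `λ` is a polarization.
[cite: Kottwitz1992, §5 (p. 389) and §8 (p. 398)] -/
structure IsPolarizingComplexStructure (J : Module.End Bℝ W) : Prop where
  /-- `J² = -1` -/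
  sq : J * J = -1
  /-- `J` preserves the form -/
  isometry : ∀ v w : W, χ (J v) (J w) = χ v w
  /-- `χ(v, Jv) > 0` for `v ≠ 0` -/
  pos : ∀ v : W, v ≠ 0 → 0 < χ v (J v)

end Real

section Shadow

variable {B : Type} [Ring B] [Algebra ℚ B] (ι : B →ₗ[ℚ] B)
variable {V : Type} [AddCommGroup V] [Module ℚ V] [Module B V] [IsScalarTower ℚ B V]
  (φ : LinearMap.BilinForm ℚ V)
variable {H : Type} [AddCommGroup H] [Module ℚ H] [Module B H] [IsScalarTower ℚ B H]
  (ψ : LinearMap.BilinForm ℚ H)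

/-- The REAL-PLACE DATA of a complex point, read on shadows (p. 398, p0026 L40 – p0027 L5): for every
presentation of the extensions of scalars of `B`, `V`, `H` to `ℝ`, `V_ℝ` carries a polarizing complex
structure `J_V = h(i)` (the datum `h` of §5), `H_ℝ` carries one, `J_H` («the natural complex structure on
`H_ℝ = Lie(A)`», polarizing since `λ` is a polarization), and `H_ℝ ≅ V_ℝ` as `B_ℝ ⊗_ℝ ℂ`-modules — a
`B_ℝ`-linear isomorphism intertwining `J_H` and `J_V` («The determinant condition … implies that `H₁` and
`V₁` are isomorphic `B_ℂ`-modules; this, together with the fact that `H_ℂ` and `V_ℂ` are isomorphic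
`B_ℂ`-modules, implies that `H_ℝ` and `V_ℝ` are isomorphic `B_ℝ ⊗_ℝ ℂ`-modules»).
[cite: Kottwitz1992, §8 (pp. 398–399)] -/
def HasCompatibleComplexStructures : Prop :=
  ∀ (Bℝ : Type) [Ring Bℝ] [Algebra ℝ Bℝ] [Algebra ℚ Bℝ] [IsScalarTower ℚ ℝ Bℝ] (ιℝ : Bℝ →ₗ[ℝ] Bℝ)
    (jB : B →ₐ[ℚ] Bℝ)
    (Vℝ : Type) [AddCommGroup Vℝ] [Module ℝ Vℝ] [Module ℚ Vℝ] [IsScalarTower ℚ ℝ Vℝ] [Module Bℝ Vℝ]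
    [IsScalarTower ℝ Bℝ Vℝ] (φℝ : LinearMap.BilinForm ℝ Vℝ) (jV : V →ₗ[ℚ] Vℝ)
    (Hℝ : Type) [AddCommGroup Hℝ] [Module ℝ Hℝ] [Module ℚ Hℝ] [IsScalarTower ℚ ℝ Hℝ] [Module Bℝ Hℝ]
    [IsScalarTower ℝ Bℝ Hℝ] (ψℝ : LinearMap.BilinForm ℝ Hℝ) (jH : H →ₗ[ℚ] Hℝ),
    IsAlgebraExtension ι ℝ ιℝ jB → IsModuleExtension φ ℝ jB φℝ jV → IsModuleExtension ψ ℝ jB ψℝ jH →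
      ∃ (JV : Module.End Bℝ Vℝ) (JH : Module.End Bℝ Hℝ),
        IsPolarizingComplexStructure φℝ JV ∧ IsPolarizingComplexStructure ψℝ JH ∧
        ∃ f : Hℝ ≃ₗ[Bℝ] Vℝ, ∀ v : Hℝ, f (JH v) = JV (f v)

/-- **[Kottwitz1992, §8 pp. 398–399] the claim at `v = ∞`**, verbatim (p0027 L5–L7): «[this] implies that
`H_ℝ` and `V_ℝ` are isomorphic `B_ℝ ⊗_ℝ ℂ`-modules. Lemma 4.2 then implies that `H_ℝ` and `V_ℝ` are
isomorphic skew-Hermitian `B_ℝ`-modules.»  TYPED for the §5 datum `(B, ι, V, φ)` (`IsRationalDatum`)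
and the shadow `(H, ψ)` of a complex point carrying the real-place data `HasCompatibleComplexStructures`:
`H` and `V` are isomorphic skew-Hermitian modules over `ℝ` (`LocallyIsomorphic … ℝ`).  Input = Lemma 4.2,
t02's landed `HermitianSymmetricSpaces.Kottwitz1992_4_2_iso` (cited, not restated).
[cite: Kottwitz1992, §8 (pp. 398–399)] -/
def Kottwitz1992_8_localIso_real : Prop :=
  IsRationalDatum ι φ → IsSkewHermitian ℚ ι ψ → Nonempty (V ≃ₗ[B] H) →
    HasCompatibleComplexStructures ι φ ψ → LocallyIsomorphic ι φ ℝ ψ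

variable (p : ℕ) [Fact p.Prime] (OB : Subring B)

/-- The `p`-adic completion `𝒪_B ⊗ ℤ_p` of the `ℤ_(p)`-order `𝒪_B ⊂ B` of §5 (p. 389: «Let `𝒪_B` be a
`ℤ_(p)`-order in `B` whose `p`-adic completion is a maximal order in `B_{ℚ_p}`»), inside a presentation
`jB : B → B_{ℚ_p}`: the `ℤ_p`-subalgebra generated by `jB(𝒪_B)`. [cite: Kottwitz1992, §5 (p. 389)] -/
noncomputable def orderCompletion {Bp : Type} [Ring Bp] [Algebra ℚ_[p] Bp] [Algebra ℤ_[p] Bp] (jB : B →+* Bp) :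
    Subalgebra ℤ_[p] Bp :=
  Algebra.adjoin ℤ_[p] (jB '' (OB : Set B))

/-- The `p`-ADIC DATA of a complex point, read on shadows (p. 399, p0027 L8–L18): for every presentation of
the extensions of scalars of `(B, ι, 𝒪_B, V, φ)` and `H` to `ℚ_p`, the §5∕§7 conditions at `p` hold
(`IsPadicDatum` over `(ℤ_[p], ℚ_[p])`, p. 395) and `H_{ℚ_p}` contains a self-dual `𝒪_B`-lattice («since `A`
is an abelian variety up to prime-to-`p` isogeny, the `ℤ_p`-module `Λ' := H₁(A, ℤ_p)` is well defined and
gives us a self-dual `𝒪_B`-lattice in `H_{ℚ_p}`»). [cite: Kottwitz1992, §8 (p. 399) with §7 (p. 395)] -/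
def HasSelfDualLatticeAt : Prop :=
  ∀ (Bp : Type) [Ring Bp] [Algebra ℚ_[p] Bp] [Algebra ℚ Bp] [IsScalarTower ℚ ℚ_[p] Bp] [Algebra ℤ_[p] Bp]
    [IsScalarTower ℤ_[p] ℚ_[p] Bp] (ιp : Bp →ₗ[ℚ_[p]] Bp) (jB : B →ₐ[ℚ] Bp)
    (Vp : Type) [AddCommGroup Vp] [Module ℚ_[p] Vp] [Module ℚ Vp] [IsScalarTower ℚ ℚ_[p] Vp]
    [Module ℤ_[p] Vp] [IsScalarTower ℤ_[p] ℚ_[p] Vp] [Module Bp Vp] [IsScalarTower ℚ_[p] Bp Vp]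
    (φp : LinearMap.BilinForm ℚ_[p] Vp) (jV : V →ₗ[ℚ] Vp)
    (Hp : Type) [AddCommGroup Hp] [Module ℚ_[p] Hp] [Module ℚ Hp] [IsScalarTower ℚ ℚ_[p] Hp]
    [Module ℤ_[p] Hp] [IsScalarTower ℤ_[p] ℚ_[p] Hp] [Module Bp Hp] [IsScalarTower ℚ_[p] Bp Hp]
    (ψp : LinearMap.BilinForm ℚ_[p] Hp) (jH : H →ₗ[ℚ] Hp),
    IsAlgebraExtension ι ℚ_[p] ιp jB → IsModuleExtension φ ℚ_[p] jB φp jV →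
    IsModuleExtension ψ ℚ_[p] jB ψp jH →
      IsPadicDatum p ιp (orderCompletion p OB (jB : B →+* Bp)) φp ∧
      ∃ Λ' : Submodule ℤ_[p] Hp,
        IsOBLattice ℚ_[p] (orderCompletion p OB (jB : B →+* Bp)) Λ' ∧ IsSelfDual ψp Λ'

/-- **[Kottwitz1992, §8 p. 399] the claim at `v = p`**, verbatim (p0027 L8–L30): «It remains to consider
the place `v = p`. In this case we simply apply Lemma 7.2. We must check that the hypotheses of that lemma
are satisfied. First of all, note that the `B_{ℚ_p}`-modules `V_{ℚ_p}` and `H_{ℚ_p}` are isomorphic. Next,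
since `A` is an abelian variety up to prime-to-`p` isogeny, the `ℤ_p`-module `Λ' := H₁(A, ℤ_p)` is well
defined and gives us a self-dual `𝒪_B`-lattice in `H_{ℚ_p}`. Finally, if we are in Case D, there are two
further conditions to check. One is that `p ≠ 2` … To check the second condition, we consider the element
`g ∈ H¹(ℚ, G)` that measures the difference between `V` and `H`. We already know that `g` is locally
trivial for all places `v ≠ p`. … Therefore the image of `g` in `H¹(ℚ, G/G⁰)` is trivial, which implies
that the last hypothesis of Lemma 7.2 is indeed satisfied.»

TYPED: for the §5 datum and the shadow `(H, ψ)` with `H ≃_B V` carrying the `p`-adic data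
`HasSelfDualLatticeAt`, with — in Case D — `p ≠ 2` and local triviality at all `v ≠ p` (the text's input
to the `H¹(ℚ, G/G⁰)` check), `H` and `V` are isomorphic skew-Hermitian modules over `ℚ_p`.
[cite: Kottwitz1992, §8 (p. 399)] -/
def Kottwitz1992_8_localIso_padic : Prop :=
  IsRationalDatum ι φ → IsSkewHermitian ℚ ι ψ → Nonempty (V ≃ₗ[B] H) → HasSelfDualLatticeAt ι φ ψ p OB →
    (IsCaseD ℚ ι φ → p ≠ 2 ∧ LocallyIsomorphic ι φ ℝ ψ ∧
      ∀ (ℓ : ℕ) [Fact ℓ.Prime], ℓ ≠ p → LocallyIsomorphic ι φ ℚ_[ℓ] ψ) →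
    LocallyIsomorphic ι φ ℚ_[p] ψ

/-- **[Kottwitz1992, §8 p. 398] the local isomorphism claim**, verbatim (p0026 L36–L38): «We claim that
for every place `v` of `ℚ` the skew-Hermitian `B_{ℚ_v}`-modules `H_{ℚ_v}` and `V_{ℚ_v}` are isomorphic. For
finite places `v` different from `p` this is an immediate consequence of the existence of `η̄`.»

TYPED for the §5 datum and the shadow `(H, ψ)` of a complex point `(A, λ, i, η̄)` — `H ≃_B V`, the level
structure `η̄` read as local isomorphism at every prime `ℓ ≠ p`, the real-place data
`HasCompatibleComplexStructures` (`h`, `Lie(A)`, determinant condition) and the `p`-adic data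
`HasSelfDualLatticeAt` (`H₁(A, ℤ_p)`), with `p ≠ 2` in Case D («If we are in Case D we assume that `p ≠ 2`»,
p. 398): `H` and `V` are isomorphic skew-Hermitian modules over `ℝ` and over EVERY `ℚ_ℓ`.
[cite: Kottwitz1992, §8 (p. 398)] -/
def Kottwitz1992_8_localIso_everywhere : Prop :=
  IsRationalDatum ι φ → IsSkewHermitian ℚ ι ψ → Nonempty (V ≃ₗ[B] H) →
    (∀ (ℓ : ℕ) [Fact ℓ.Prime], ℓ ≠ p → LocallyIsomorphic ι φ ℚ_[ℓ] ψ) →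
    HasCompatibleComplexStructures ι φ ψ → HasSelfDualLatticeAt ι φ ψ p OB → (IsCaseD ℚ ι φ → p ≠ 2) →
      LocallyIsomorphic ι φ ℝ ψ ∧ ∀ (ℓ : ℕ) [Fact ℓ.Prime], LocallyIsomorphic ι φ ℚ_[ℓ] ψ

/-! ## Finiteness of the locally trivial classes [BS] (p. 399) -/

/-- **[Kottwitz1992, §8 p. 399] finiteness**, verbatim (p0027 L31–L35): «Isomorphism classes of
skew-Hermitian `B`-modules of the same dimension as `V` are classified by `H¹(ℚ, G)`, and therefore by
[BS] there are finitely many isomorphism classes of skew-Hermitian `B`-modules `(V', (·,·)')` such that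
`V'_{ℚ_v}` and `V_{ℚ_v}` are isomorphic for all places `v` of `ℚ`; we choose representatives
`V^{(1)}, …, V^{(m)}` in these isomorphism classes».  ([BS] = A. Borel, J.-P. Serre, *Théorèmes de
finitude en cohomologie galoisienne*, Comment. Math. Helv. 39 (1964).)

TYPED (READING R-H1): for the §5 datum there is a bound `m` such that among any `m + 1` nondegenerate
skew-Hermitian `B`-modules, each `B`-isomorphic to `V` and locally isomorphic to `V` at `∞` and at every
prime, two are isomorphic over `ℚ`. [cite: Kottwitz1992, §8 (p. 399)] -/
def Kottwitz1992_8_finitely_many_classes : Prop :=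
  IsRationalDatum ι φ →
    ∃ m : ℕ, ∀ (W : Fin (m + 1) → Type) [∀ i, AddCommGroup (W i)] [∀ i, Module ℚ (W i)]
      [∀ i, Module B (W i)] [∀ i, IsScalarTower ℚ B (W i)] (χ : ∀ i, LinearMap.BilinForm ℚ (W i)),
      (∀ i, IsSkewHermitian ℚ ι (χ i) ∧ Nonempty (V ≃ₗ[B] W i) ∧ LocallyIsomorphic ι φ ℝ (χ i) ∧
        ∀ (ℓ : ℕ) [Fact ℓ.Prime], LocallyIsomorphic ι φ ℚ_[ℓ] (χ i)) →
      ∃ i j : Fin (m + 1), i ≠ j ∧ Isomorphic (χ i) (χ j) B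

/-! ## Case A, `n` odd: the twist by `a ∈ F₀^×` (p. 400) -/

/-- **[Kottwitz1992, §8 p. 400] the twisting automorphism and the `|ker¹(ℚ, G)|` components**, verbatim
(p0028 L25–L31, L40–L44): «Let `z` belong to `ker¹(ℚ, Z)` and represent `z` by an element `a ∈ F₀^×`. …
we may assume that `a` is totally positive and that it is a unit at every place of `F` lying over `p`.
Define an automorphism of `S_{K^p}` by sending an `S`-valued point `(A, λ, i, η̄)` to the point
`(A, λ∘i(a), i, βη̄)` … Let `z_i` be the element of `ker¹(ℚ, Z)` mapping to the element of `ker¹(ℚ, G)`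
determined by the skew-Hermitian `B`-module `V^{(i)}`. Then any one of the automorphisms of `S_{K^p}`
associated to `z_i` maps `S_K^{(1)}` isomorphically to `S_K^{(i)}` … Therefore our moduli space over `E` is
just a disjoint union of `|ker¹(ℚ, G)|` copies of the canonical model `S_K^{(1)}` for `(G, h⁻¹, K^p)`.»

TYPED, on shadows (READINGS R-H1, R-Z of the §7 carpet): the automorphism replaces the shadow `(H, ψ)`
of a point by `(H, ψ_a)`, `ψ_a(v, w) = ψ(a v, w)` (`GroupStructure.twistForm`); if `(H, ψ)` lies in the
class of `V = V^{(1)}` (isomorphic over `ℚ`) then `(H, ψ_a)` lies in the class of `(V, φ_a)` — the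
representative of the image of `z = [a]` in `ker¹(ℚ, G)` — and, `a` being locally a norm times a scalar,
`(H, ψ_a)` is again locally isomorphic to `V` everywhere.  That these classes exhaust `ker¹(ℚ, G)`
(`m = |ker¹(ℚ, G)|`) is the §7 carpet's `Kottwitz1992_7_kerOne_center_bijective`; the canonical-model
sentence is not typed (module docstring). [cite: Kottwitz1992, §8 (p. 400)] -/
def Kottwitz1992_8_twist_class : Prop :=
  IsRationalDatum ι φ → IsCaseA ℚ ι →
    ∀ a : B, a ∈ Subalgebra.center ℚ B → ι a = a → IsUnit a →
      CentralClassTrivialOver ι ℝ a → (∀ (ℓ : ℕ) [Fact ℓ.Prime], CentralClassTrivialOver ι ℚ_[ℓ] a) →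
      IsSkewHermitian ℚ ι ψ → Isomorphic φ ψ B →
        Isomorphic (twistForm φ a) (twistForm ψ a) B ∧
        LocallyIsomorphic ι φ ℝ (twistForm ψ a) ∧
        ∀ (ℓ : ℕ) [Fact ℓ.Prime], LocallyIsomorphic ι φ ℚ_[ℓ] (twistForm ψ a)

end Shadow

end Literature.NumberTheory.Kottwitz1992.ComplexPoints
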